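import Summits.ABC.IUTFork.Conditional.AbcOfSHvolAdmissibleWindow
import Literature.NumberTheory.DiophantineGeometry.GenEllNorthcott
import Mathlib.NumberTheory.Chebyshev
import HarnessLib

/-!
# Branch C, TARGET #1 (`hvol` / `hreg`): the EXPLICIT content of the CONE binder on the admissible degree-2 family —
# `log-diff + log-cond ≥ k·log 7/48 − C·h^{1/2}·log(2δ₂h) − 13`, every hypothesis of [IUTchIV] Cor. 2.2 (ii) discharged
# (abc-iut cell, R2 S-chain team, seat abc-iut-s2-p3 gen 2; sequel of `AbcOfSHvolAdmissibleWindow`)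

Record-only PROOF file (D-0012) of the abc-iut cell; TAKES NO SIDE on [IUTchIII] Cor. 3.12 or [IUTchIV] Thm. 1.10.
S. Mochizuki, *IUT IV* [Mochizuki2012], Cor. 2.2 (ii) proof (P1) pp. 44–45; Thm. 1.10 Steps (v), (viii) pp. 27–29.
[claim: Mochizuki2012, status: disputed] for every IUT quotation; the content of THIS file is classical
(Chebyshev's bound for `π(x)`, Mathlib `Chebyshev.pi_le_log4_mul_div`; Weil heights, Mathlib `Height.logHeight₁_*`).

`Conditional.splitDepthWindow_quadWitness_of_hvol` (the parent file) reads the CONE binder `hvol` of `Conditional.abc_of_S_v3`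
(p430884) on abc-iut-s2-p5's admissible family `P_k = (ℚ(√2), λ_k)`, `λ_k = 1/2 + 2/(3+√2)^k`, with the prime in print's (P1)
window: `k·log 7/12 − E(l) ≤ (1 + 24/l)·(log-diff(P_k) + log-cond^{∤{2,l}}(λ_k))`, `E(l) = 2 log l + 52 + (20/3)·log(d*l)·π(d*l)`,
`d* = 2^13·3^3·5`, `h_k^{1/2} ≤ l ≤ 10δ₂·h_k^{1/2}·log(2δ₂h_k)`, `h_k = log(q^∀(λ_k)) ≥ k·log 2`. THIS FILE makes the error
term explicit and sub-linear:

* `Cor22Window.log_mul_primeCounting_le` — `log n · π(n) ≤ 5n` (`n ≥ 2`; Chebyshev: `π(x) ≤ log 4·x/log √x + √x`);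
* `Cor22Window.errTerm_le` — `E(l) ≤ 34·d*·l + 52`;
* **`Conditional.logCond_lower_bound_quadWitness_of_hvol`** — `hvol` VERBATIM ⟹ ∃ `k₀` ∀ `k ≥ k₀` ∃ an ADMISSIBLE prime `l`
  (PROVED (P2), (P5), (P6), in the (P1) window) with
  `k·log 7/48 − 85·δ₂²·h_k^{1/2}·log(2δ₂·h_k) − 13 ≤ log-diff(P_k) + log-cond^{∤{2,l}}(λ_k)` and `k·log 2 ≤ h_k`
  (`δ₂ = delta 2 = 2^13·3^3·5`);
* `Conditional.logQForall_quadWitness_le` — `h_k ≤ A + B·k` (Weil-height arithmetic of `j(λ_k)`; `A, B` from the heights of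
  `2`, `3+√2` and `[ℚ(√2):ℚ]`), so the error is `O(k^{1/2}·log k)`:
* **`Conditional.logCond_linear_lower_bound_of_hvol`** — `hvol` ⟹ ∃ `A B k₀` ∀ `k ≥ k₀` ∃ admissible `l`:
  `k·log 7/48 − 85·δ₂²·(A+Bk)^{1/2}·log(2δ₂(A+Bk)) − 13 ≤ log-diff(P_k) + log-cond^{∤{2,l}}(λ_k)`.

READING (for the planners; nothing asserted about print or any author). `log-diff(P_k) = (1/2)·log 8` is constant and
`log-cond^{∤{2,l}}(λ_k) ≤ (1/2)·log rad N(λ_k(1−λ_k))`-type; so the CONE binder of the S_H line of record asserts an EFFECTIVE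
abc/Szpiro-type lower bound, LINEAR in `k` with an explicit `O(k^{1/2} log k)` error, for the conductor of the explicit family
`λ_k = 1/2 + 2/(3+√2)^k` — with (P2), (P5), (P6), `P_k ∈ UP ∩ K_V`, `d_mod = 2` all THEOREMS. Such a bound is open in print
(unconditional results are of Stewart–Yu type, `log h ≪ rad^{1/3+ε}`). This is the TARGET #1 obstruction certificate with no
hypothesis left on the necessity side. HONEST SCOPE: consequences of the typed binder; typed ≠ proved; no side taken.
PROOF-ONLY file: no definitions, no `Prop` facts. [cite: Mochizuki2012, IUTchIV Cor. 2.2 (ii) proof (P1) p. 44–45]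
[cite: Mochizuki2012, IUTchIV Thm. 1.10 Steps (v)(viii) p. 27–29] [cite: MochizukiGenEll2010, Ex 1.3 (ii) p.5]
-/

noncomputable section

namespace Summit.ABC.IUTFork

open NumberField IsDedekindDomain Literature.IUT.LogVolume Literature.IUT.HodgeTheaters
open Literature.NumberTheory.DiophantineGeometry.GenEll
open scoped Classical

/-! ## §1. Chebyshev: `log n · π(n) ≤ 5n`, and the error term `E(l) ≤ 34·d*·l + 52` -/

namespace Cor22Window

/-- **`log n · π(n) ≤ 5·n`** for `n ≥ 2`: Mathlib's explicit Chebyshev bound `π(x) ≤ log 4·x/log √x + √x` at `x = n`, times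
`log n`, with `√n·log n ≤ 2n` and `4·log 2 < 3`. [folklore] -/
theorem log_mul_primeCounting_le {n : ℕ} (hn : 2 ≤ n) :
    Real.log n * (Nat.primeCounting n : ℝ) ≤ 5 * n := by
  have hn1 : (1 : ℝ) < n := by exact_mod_cast hn
  have hn0 : (0 : ℝ) < n := by linarith
  have hlog : 0 < Real.log n := Real.log_pos hn1
  have h := Chebyshev.pi_le_log4_mul_div hn1
  rw [Nat.floor_natCast, Real.log_sqrt hn0.le] at h
  -- `π n ≤ 2·log 4·n/log n + √n`
  have h' : (Nat.primeCounting n : ℝ) ≤ 2 * Real.log 4 * n / Real.log n + Real.sqrt n := by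
    have e : Real.log 4 * (n : ℝ) / (Real.log n / 2) = 2 * Real.log 4 * n / Real.log n := by
      field_simp
    rw [e] at h
    exact h
  have hsq : Real.sqrt n * Real.log n ≤ 2 * n := by
    have hs0 : 0 < Real.sqrt n := Real.sqrt_pos.mpr hn0
    have h1 : Real.log (Real.sqrt n) ≤ Real.sqrt n - 1 := Real.log_le_sub_one_of_pos hs0
    rw [Real.log_sqrt hn0.le] at h1
    have h2 : Real.log n ≤ 2 * Real.sqrt n := by linarith
    calc Real.sqrt n * Real.log n ≤ Real.sqrt n * (2 * Real.sqrt n) := mul_le_mul_of_nonneg_left h2 hs0.le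
      _ = 2 * n := by rw [mul_comm, mul_assoc, Real.mul_self_sqrt hn0.le]
  have hlog4 : Real.log 4 < 3 / 2 := by
    have h4 : Real.log 4 = 2 * Real.log 2 := by
      have h := Real.log_pow 2 2
      norm_num at h
      exact h
    rw [h4]
    have := Real.log_two_lt_d9
    linarith
  calc Real.log n * (Nat.primeCounting n : ℝ)
      ≤ Real.log n * (2 * Real.log 4 * n / Real.log n + Real.sqrt n) := mul_le_mul_of_nonneg_left h' hlog.le
    _ = 2 * Real.log 4 * n + Real.sqrt n * Real.log n := by field_simp
    _ ≤ 2 * (3 / 2) * n + 2 * n := by nlinarith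
    _ = 5 * n := by ring

/-- **`E(l) ≤ 34·d*·l + 52`** (`d* = 2^13·3^3·5`, `l ≥ 1`): `2 log l ≤ 2l`, `log(d*l)·π(d*l) ≤ 5·d*·l`. [folklore] -/
theorem errTerm_le {l : ℕ} (hl : 1 ≤ l) :
    2 * Real.log l + 52 + 20 / 3 * Real.log (((2 ^ 13 * 3 ^ 3 * 5 : ℕ) : ℝ) * (l : ℝ))
        * (Nat.primeCounting (2 ^ 13 * 3 ^ 3 * 5 * l) : ℝ) ≤
      34 * ((2 ^ 13 * 3 ^ 3 * 5 : ℕ) : ℝ) * l + 52 := by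
  have hl0 : (0 : ℝ) ≤ l := by positivity
  have hl1 : (1 : ℝ) ≤ l := by exact_mod_cast hl
  have h2 : 2 ≤ 2 ^ 13 * 3 ^ 3 * 5 * l := by
    calc 2 ≤ 2 ^ 13 * 3 ^ 3 * 5 * 1 := by norm_num
      _ ≤ 2 ^ 13 * 3 ^ 3 * 5 * l := Nat.mul_le_mul_left _ hl
  have hpi := log_mul_primeCounting_le h2
  have hcast : (((2 ^ 13 * 3 ^ 3 * 5 * l : ℕ) : ℝ)) = ((2 ^ 13 * 3 ^ 3 * 5 : ℕ) : ℝ) * (l : ℝ) := by push_cast; ring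
  rw [hcast] at hpi
  have hlogl : Real.log l ≤ l := Real.log_le_self hl0
  have hc : ((2 ^ 13 * 3 ^ 3 * 5 : ℕ) : ℝ) = 1105920 := by norm_num
  rw [hc] at hpi ⊢
  rw [mul_assoc (20 / 3 : ℝ)]
  have h3 : (20 / 3 : ℝ) * (Real.log (1105920 * (l : ℝ)) * (Nat.primeCounting (2 ^ 13 * 3 ^ 3 * 5 * l) : ℝ)) ≤
      (20 / 3 : ℝ) * (5 * (1105920 * (l : ℝ))) := mul_le_mul_of_nonneg_left hpi (by norm_num)
  have h4 : 2 * Real.log l ≤ 2 * (l : ℝ) := by linarith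
  have h5 : (20 / 3 : ℝ) * (5 * (1105920 * (l : ℝ))) + 2 * (l : ℝ) ≤ 34 * 1105920 * (l : ℝ) := by nlinarith
  linarith

end Cor22Window

/-! ## §2. The explicit lower bound for `log-diff + log-cond` on the admissible family -/

namespace Conditional

/-- **`hvol` ⟹ `log-diff(P_k) + log-cond^{∤{2,l}}(λ_k) ≥ k·log 7/48 − 85·δ₂²·h_k^{1/2}·log(2δ₂h_k) − 13` at an ADMISSIBLE prime
`l` in the (P1) window, for all large `k`.** Here `P_k = (ℚ(√2), 1/2 + 2/(3+√2)^k)` (abc-iut-s2-p5), `h_k = log(q^∀(λ_k)) ≥ k·log 2`,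
`δ₂ = delta 2 = 2^13·3^3·5`; (P2), (P5), (P6) at `(P_k, l)` are PROVED (parent file). From `splitDepthWindow_quadWitness_of_hvol`:
`(1+24/l)·(log-diff + log-cond) ≥ k·log 7/12 − E(l)` with `1 + 24/l ≤ 4` (`l ≥ 11`), `log-diff, log-cond ≥ 0`,
`E(l) ≤ 34·d*·l + 52` (`Cor22Window.errTerm_le`) and `l ≤ 10δ₂·h^{1/2}·log(2δ₂h)`, `d* = δ₂`. Nothing asserted about any point,
about print, or about any author; typed ≠ proved. [cite: Mochizuki2012, IUTchIV Cor. 2.2 (ii) proof (P1) p. 44–45]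
[cite: Mochizuki2012, IUTchIV Thm. 1.10 Steps (v)(viii) p. 27–29] [claim: Mochizuki2012, status: disputed] -/
theorem logCond_lower_bound_quadWitness_of_hvol
    (hvol : ∀ P₀ : NFPoint, P₀ ∈ UP → ∀ l : ℕ, l.Prime → 5 ≤ l →
      Cor22.AdmitsCore P₀ → Cor22.CondP2 P₀ l → Cor22.CondP5 P₀ l → Cor22.CondP6 P₀ l →
        Cor22.HullVolumeAtDatum P₀ l (((l : ℝ) + 1) / 4 *
          ((1 + 12 * (Cor22.dmod P₀ : ℝ) / l) * (P₀.logDiff + Cor22.logCondAvoid P₀ {2, l})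
            + 2 * Real.log l + 52
            + 20 / 3 * Real.log (((2 ^ 12 * 3 ^ 3 * 5 * Cor22.dmod P₀ : ℕ) : ℝ) * (l : ℝ))
              * (Nat.primeCounting (2 ^ 12 * 3 ^ 3 * 5 * Cor22.dmod P₀ * l) : ℝ)))) :
    ∃ k₀ : ℕ, ∀ k : ℕ, k₀ ≤ k →
      ∃ l : ℕ, l.Prime ∧ 7 ≤ l ∧ l ≠ 7 ∧ Cor22.CondP2 (QuadWitness.P k) l ∧ Cor22.CondP5 (QuadWitness.P k) l ∧
        Cor22.CondP6 (QuadWitness.P k) l ∧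
        Real.sqrt (Cor22.logQForall (QuadWitness.P k)) ≤ l ∧
        (l : ℝ) ≤ 10 * Cor22.delta 2 * Real.sqrt (Cor22.logQForall (QuadWitness.P k)) *
          Real.log (2 * Cor22.delta 2 * Cor22.logQForall (QuadWitness.P k)) ∧
        (k : ℝ) * Real.log 2 ≤ Cor22.logQForall (QuadWitness.P k) ∧
        (k : ℝ) * Real.log 7 / 48
            - 85 * Cor22.delta 2 ^ 2 * Real.sqrt (Cor22.logQForall (QuadWitness.P k)) *
                Real.log (2 * Cor22.delta 2 * Cor22.logQForall (QuadWitness.P k))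
            - 13 ≤
          (QuadWitness.P k).logDiff + Cor22.logCondAvoid (QuadWitness.P k) {2, l} := by
  obtain ⟨k₀, hk₀⟩ := splitDepthWindow_quadWitness_of_hvol hvol
  refine ⟨k₀, fun k hk => ?_⟩
  obtain ⟨l, hlp, hl7, hl7', hP2, hP5, hP6, hlo, hhi, hlogQ, -, hineq⟩ := hk₀ k hk
  refine ⟨l, hlp, hl7, hl7', hP2, hP5, hP6, hlo, hhi, hlogQ, ?_⟩
  -- abbreviations
  set h : ℝ := Cor22.logQForall (QuadWitness.P k) with hh
  set D : ℝ := (QuadWitness.P k).logDiff + Cor22.logCondAvoid (QuadWitness.P k) {2, l} with hD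
  have hD0 : 0 ≤ D := add_nonneg (NFPoint.logDiff_nonneg _) (Cor22.logCondAvoid_nonneg _ _)
  -- `l ≥ 11` (a prime `≥ 7`, `≠ 7`), so `1 + 24/l ≤ 4`
  have hl11 : 11 ≤ l := by
    rcases Nat.lt_or_ge l 11 with hlt | hge
    · interval_cases l <;> simp_all (config := {decide := true})
    · exact hge
  have hl11' : (11 : ℝ) ≤ l := by exact_mod_cast hl11
  have hlpos : (0 : ℝ) < l := by linarith
  have hcoef : 1 + 24 / (l : ℝ) ≤ 4 := by
    have : 24 / (l : ℝ) ≤ 3 := by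
      rw [div_le_iff₀ hlpos]
      linarith
    linarith
  have h4 : (1 + 24 / (l : ℝ)) * D ≤ 4 * D := mul_le_mul_of_nonneg_right hcoef hD0
  -- the error term
  have hE := Cor22Window.errTerm_le (l := l) (by omega)
  have hc : ((2 ^ 13 * 3 ^ 3 * 5 : ℕ) : ℝ) = Cor22.delta 2 := by simp [Cor22.delta]; norm_num
  have hE' : 2 * Real.log l + 52 + 20 / 3 * Real.log (((2 ^ 13 * 3 ^ 3 * 5 : ℕ) : ℝ) * (l : ℝ))
        * (Nat.primeCounting (2 ^ 13 * 3 ^ 3 * 5 * l) : ℝ) ≤ 34 * Cor22.delta 2 * l + 52 := by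
    rw [← hc]; exact hE
  -- `34·δ₂·l ≤ 340·δ₂²·√h·log(2δ₂h)`
  have hδ : (0 : ℝ) ≤ Cor22.delta 2 := by simp [Cor22.delta]
  have hl' : 34 * Cor22.delta 2 * (l : ℝ) ≤
      340 * Cor22.delta 2 ^ 2 * Real.sqrt h * Real.log (2 * Cor22.delta 2 * h) := by
    have := mul_le_mul_of_nonneg_left hhi (by positivity : (0 : ℝ) ≤ 34 * Cor22.delta 2)
    have e : 34 * Cor22.delta 2 * (10 * Cor22.delta 2 * Real.sqrt h * Real.log (2 * Cor22.delta 2 * h)) =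
        340 * Cor22.delta 2 ^ 2 * Real.sqrt h * Real.log (2 * Cor22.delta 2 * h) := by ring
    rw [e] at this
    exact this
  linarith

/-! ### The height of the family is linear in `k` -/

/-- **`h_k = log(q^∀(λ_k)) ≤ A + B·k`** with `A, B ≥ 0` depending only on `ℚ(√2)`, `2` and `3+√2` (Weil-height arithmetic:
`log(q^∀) ≤ ht_∞ = (1/2)·h(j(λ_k))` (`Cor22.logQForall_le_htInfty`), `h(j(λ)) ≤ 13·h(λ) + const` for
`j = 2^8(λ²−λ+1)^3/(λ²(λ−1)^2)`, `h(λ_k) ≤ k·h(3+√2) + const` — Mathlib `Height.logHeight₁_{mul,add,sub}_le/_inv/_pow`).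
[cite: MochizukiGenEll2010, Prop 1.4 (ii) p.6] -/
theorem logQForall_quadWitness_le :
    ∃ A B : ℝ, 0 ≤ A ∧ 0 ≤ B ∧ ∀ k : ℕ, Cor22.logQForall (QuadWitness.P k) ≤ A + B * k := by
  -- Weil-height bookkeeping over `F = ℚ(√2)`
  set W : ℝ := (Height.totalWeight QuadWitness.F : ℝ) * Real.log 2 with hW
  set h2 : ℝ := Height.logHeight₁ (2 : QuadWitness.F) with hh2
  set ha : ℝ := Height.logHeight₁ ((QuadWitness.a : 𝓞 QuadWitness.F) : QuadWitness.F) with hha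
  have hnn : ∀ y : QuadWitness.F, 0 ≤ Height.logHeight₁ y := fun y => by
    rw [Height.logHeight₁_eq_log_mulHeight₁]; exact Real.log_nonneg (Height.one_le_mulHeight₁ _)
  have hW0 : 0 ≤ W := by positivity
  have h20 : 0 ≤ h2 := hnn _
  have ha0 : 0 ≤ ha := hnn _
  -- `h(λ_k) ≤ W + 2·h(2) + k·h(a)`
  have hlam : ∀ k : ℕ, Height.logHeight₁ (QuadWitness.lam k) ≤ W + 2 * h2 + k * ha := by
    intro k
    have h1 : Height.logHeight₁ (QuadWitness.lam k) ≤
        W + Height.logHeight₁ ((2 : QuadWitness.F)⁻¹) +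
          Height.logHeight₁ (2 / ((QuadWitness.a : 𝓞 QuadWitness.F) : QuadWitness.F) ^ k) :=
      Height.logHeight₁_add_le _ _
    have h2' : Height.logHeight₁ ((2 : QuadWitness.F)⁻¹) = h2 := Height.logHeight₁_inv _
    have h3 : Height.logHeight₁ (2 / ((QuadWitness.a : 𝓞 QuadWitness.F) : QuadWitness.F) ^ k) ≤ h2 + k * ha := by
      rw [div_eq_mul_inv]
      refine (Height.logHeight₁_mul_le _ _).trans ?_
      rw [Height.logHeight₁_inv, Height.logHeight₁_pow]
    linarith
  -- `h(j(λ)) ≤ 8·h(2) + 11·W + 13·h(λ)` for every `λ`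
  have hj : ∀ x : QuadWitness.F, Height.logHeight₁ (Cor22.jInv x) ≤ 11 * W + 8 * h2 + 13 * Height.logHeight₁ x := by
    intro x
    set hx : ℝ := Height.logHeight₁ x with hhx
    have hx0 : 0 ≤ hx := hnn _
    unfold Cor22.jInv
    rw [div_eq_mul_inv]
    refine (Height.logHeight₁_mul_le _ _).trans ?_
    rw [Height.logHeight₁_inv]
    have hA : Height.logHeight₁ ((2 : QuadWitness.F) ^ 8 * (x ^ 2 - x + 1) ^ 3) ≤ 8 * h2 + 3 * (2 * W + 3 * hx) := by
      refine (Height.logHeight₁_mul_le _ _).trans ?_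
      rw [Height.logHeight₁_pow, Height.logHeight₁_pow]
      have hq : Height.logHeight₁ (x ^ 2 - x + 1) ≤ 2 * W + 3 * hx := by
        refine (Height.logHeight₁_add_le _ _).trans ?_
        rw [Height.logHeight₁_one]
        have : Height.logHeight₁ (x ^ 2 - x) ≤ W + 2 * hx + hx := by
          refine (Height.logHeight₁_sub_le _ _).trans ?_
          rw [Height.logHeight₁_pow]
          push_cast; linarith
        linarith
      push_cast
      nlinarith
    have hB : Height.logHeight₁ (x ^ 2 * (x - 1) ^ 2) ≤ 2 * hx + 2 * (W + hx) := by
      refine (Height.logHeight₁_mul_le _ _).trans ?_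
      rw [Height.logHeight₁_pow, Height.logHeight₁_pow]
      have : Height.logHeight₁ (x - 1) ≤ W + hx + 0 := by
        refine (Height.logHeight₁_sub_le _ _).trans ?_
        rw [Height.logHeight₁_one]
      push_cast
      nlinarith
    linarith
  refine ⟨(11 * W + 8 * h2 + 13 * (W + 2 * h2)) / 2, 13 * ha / 2, by positivity, by positivity, fun k => ?_⟩
  have hdeg : ((QuadWitness.P k).degree : ℝ) = 2 := by
    change ((Module.finrank ℚ QuadWitness.F : ℕ) : ℝ) = 2
    rw [QuadWitness.finrank_F]; norm_num
  have h1 := Cor22.logQForall_le_htInfty (QuadWitness.P k)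
  have h2'' : Cor22.htInfty (QuadWitness.P k) = 2⁻¹ * Height.logHeight₁ (Cor22.jInv (QuadWitness.lam k)) := by
    unfold Cor22.htInfty
    rw [hdeg]
  rw [h2''] at h1
  have h3 := hj (QuadWitness.lam k)
  have h4 := hlam k
  nlinarith

/-- **THE CONE BINDER ⟹ AN EFFECTIVE SZPIRO-TYPE BOUND, LINEAR IN `k`, ON AN EXPLICIT ADMISSIBLE FAMILY.** Assume `hvol` VERBATIM
(`Conditional.abc_of_S_v3`, p430884). Then there are `A, B ≥ 0` and `k₀` such that for every `k ≥ k₀` the point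
`P_k = (ℚ(√2), 1/2 + 2/(3+√2)^k) ∈ UP ∩ K_V` (`d_mod = 2`, admitting a core — abc-iut-s2-p5) carries a prime `l ≥ 7` with (P2), (P5),
(P6) PROVED, at which
`k·log 7/48 − 85·δ₂²·(A + B·k)^{1/2}·log(2δ₂·(A + B·k)) − 13 ≤ log-diff(P_k) + log-cond^{∤{2,l}}(λ_k)`, `δ₂ = 2^13·3^3·5`:
main term LINEAR in `k`, error `O(k^{1/2} log k)`. Every hypothesis of [IUTchIV] Cor. 2.2 (ii) at `(P_k, l)` is a theorem of the
tree; what remains is exactly the Diophantine content of the binder. Nothing asserted about any point, about print, or about any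
author; no side taken on [IUTchIII] Cor. 3.12; typed ≠ proved. [cite: Mochizuki2012, IUTchIV Cor. 2.2 (ii) proof (P1)–(P7) p. 44–46]
[cite: Mochizuki2012, IUTchIV Thm. 1.10 Steps (v)(viii) p. 27–29] [claim: Mochizuki2012, status: disputed] -/
theorem logCond_linear_lower_bound_of_hvol
    (hvol : ∀ P₀ : NFPoint, P₀ ∈ UP → ∀ l : ℕ, l.Prime → 5 ≤ l →
      Cor22.AdmitsCore P₀ → Cor22.CondP2 P₀ l → Cor22.CondP5 P₀ l → Cor22.CondP6 P₀ l →
        Cor22.HullVolumeAtDatum P₀ l (((l : ℝ) + 1) / 4 *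
          ((1 + 12 * (Cor22.dmod P₀ : ℝ) / l) * (P₀.logDiff + Cor22.logCondAvoid P₀ {2, l})
            + 2 * Real.log l + 52
            + 20 / 3 * Real.log (((2 ^ 12 * 3 ^ 3 * 5 * Cor22.dmod P₀ : ℕ) : ℝ) * (l : ℝ))
              * (Nat.primeCounting (2 ^ 12 * 3 ^ 3 * 5 * Cor22.dmod P₀ * l) : ℝ)))) :
    ∃ (A B : ℝ) (k₀ : ℕ), 0 ≤ A ∧ 0 ≤ B ∧ ∀ k : ℕ, k₀ ≤ k →
      ∃ l : ℕ, l.Prime ∧ 7 ≤ l ∧ Cor22.CondP2 (QuadWitness.P k) l ∧ Cor22.CondP5 (QuadWitness.P k) l ∧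
        Cor22.CondP6 (QuadWitness.P k) l ∧
        (k : ℝ) * Real.log 7 / 48 - 85 * Cor22.delta 2 ^ 2 * Real.sqrt (A + B * k) * Real.log (2 * Cor22.delta 2 * (A + B * k))
            - 13 ≤
          (QuadWitness.P k).logDiff + Cor22.logCondAvoid (QuadWitness.P k) {2, l} := by
  obtain ⟨A, B, hA, hB, hAB⟩ := logQForall_quadWitness_le
  obtain ⟨k₀, hk₀⟩ := logCond_lower_bound_quadWitness_of_hvol hvol
  refine ⟨A, B, max k₀ 2, hA, hB, fun k hk => ?_⟩
  have hk0 : k₀ ≤ k := (le_max_left _ _).trans hk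
  have hk2 : 2 ≤ k := (le_max_right _ _).trans hk
  obtain ⟨l, hlp, hl7, -, hP2, hP5, hP6, -, -, hlogQ, hmain⟩ := hk₀ k hk0
  refine ⟨l, hlp, hl7, hP2, hP5, hP6, le_trans ?_ hmain⟩
  set h : ℝ := Cor22.logQForall (QuadWitness.P k) with hh
  have hle : h ≤ A + B * k := hAB k
  have hδ : (1 : ℝ) ≤ Cor22.delta 2 := by simp [Cor22.delta]; norm_num
  -- `1 ≤ h` (from `h ≥ k·log 2`, `k ≥ 2`), so both factors of `√h·log(2δ₂h)` are nonnegative and monotone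
  have hk2' : (2 : ℝ) ≤ k := by exact_mod_cast hk2
  have h1 : (1 : ℝ) ≤ h := by
    have := Real.log_two_gt_d9
    nlinarith
  have ht1 : (1 : ℝ) ≤ A + B * k := h1.trans hle
  have hsqrt : Real.sqrt h ≤ Real.sqrt (A + B * k) := Real.sqrt_le_sqrt hle
  have hlog0 : 0 ≤ Real.log (2 * Cor22.delta 2 * h) := Real.log_nonneg (by nlinarith)
  have hlog : Real.log (2 * Cor22.delta 2 * h) ≤ Real.log (2 * Cor22.delta 2 * (A + B * k)) :=
    Real.log_le_log (by positivity) (by nlinarith)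
  have hprod : Real.sqrt h * Real.log (2 * Cor22.delta 2 * h) ≤
      Real.sqrt (A + B * k) * Real.log (2 * Cor22.delta 2 * (A + B * k)) :=
    mul_le_mul hsqrt hlog hlog0 (Real.sqrt_nonneg _)
  have hδ2 : (0 : ℝ) ≤ 85 * Cor22.delta 2 ^ 2 := by positivity
  have := mul_le_mul_of_nonneg_left hprod hδ2
  nlinarith

end Conditional

end Summit.ABC.IUTFork

end
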